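import Literature.AlgebraicGeometry.HodgeTheory.FermatInductiveClaimsLiteralForms
import Literature.AlgebraicGeometry.HodgeTheory.GysinKernelProofs
import Literature.AlgebraicGeometry.Motives.ProjectiveSpaceLinearMaps
import Literature.AlgebraicGeometry.Motives.ProjectiveSpaceLinearSubspaceSection
import HarnessLib

/-!
# The cycle class of Shioda's linear subspace `L_{σ,ε} ⊂ X²ʳₘ` via the Gysin morphism, supported on `L`

Family `hodge`, layer `Literature/AlgebraicGeometry/HodgeTheory`. Second proof file for the named
fact `Shioda_claim_paired` (`FermatInductiveClaims`; Aoki, J. Math. Soc. Japan 39 (1987) Thm. 1-1 =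
Shioda: "the linear space `L` represents `δ`"), continuing `ShiodaClaimPairedProofs`, which reduced
the fact to (A) "`V(α)` is a line" and (B2) "some class supported on `Z_{σ,ε} = X²ʳₘ ∩ L_{σ,ε}` has
`π_δ ≠ 0`". This file CONSTRUCTS the class meant in (B2) — the cycle class `cl(L)` — on the tree's
carriers and PROVES that it is supported on `Z_{σ,ε}`, so that what remains of Thm. 1-1 is
literally the printed non-vanishing `ω_δ(L) ≠ 0` of the `δ`-component of ONE explicit class
(`Shioda_claim_paired_of_projector_fermatLinearSubspaceClass_ne_zero`). Everything is PROVED; no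
named fact is introduced (D-0026).

* `pairOrbitIndex`, `pairedSubst` — for a fixed-point-free involution `σ` of the `2r + 2` coordinates
  and scalars `ε`, the substitution `x_{σ i} ↦ y_{[i]}`, `xᵢ ↦ εᵢ y_{[i]}` (`i < σ i`, `[i]` the
  index of the orbit `{i, σ i}`), i.e. the homogeneous coordinates `y ∈ ℙʳ` of `L_{σ,ε}`; it hits
  every `y_j` (`exists_pairedSubst_eq_X`), kills the equations `xᵢ - εᵢ x_{σ i}` of `L`
  (`aeval_pairedSubst_pairedLinearForm`) and, when `εᵢᵐ = -1`, the Fermat form: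
  `Σ xᵢᵐ ↦ Σ_{i<σi} (εᵢᵐ + 1) y_{[i]}ᵐ = 0` (`aeval_pairedSubst_fermatPolynomial`; sums over the
  orbits, `sum_eq_sum_filter_lt_add`) — "`L ⊂ Xⁿₘ`".
* `pairedLinEmb`, `linearSubspaceEmb` — the linear map `ℙʳ → ℙ²ʳ⁺¹` (`Motives.ProjectiveSpace.linSubstMap`)
  and its lift `g : ℙʳ_ℂ ⟶ X²ʳₘ` through the reduced closed subscheme `X²ʳₘ = V₊(Σ xᵢᵐ)`
  (`Motives.liftOfRangeSubset`, Hartshorne II Ex. 3.11 (d)), with `g(ℙʳ) ⊆ Z_{σ,ε}`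
  (`range_linearSubspaceEmb_subset`).
* `fermatLinearSubspaceClass μ = g_* 1 ∈ H²ʳ(X²ʳₘ(ℂ); ℂ)` — **the cycle class of `L`** as the Gysin
  image of `1 ∈ H⁰(ℙʳ(ℂ); ℂ)` (the tree's `complexGysin`, Fulton, Young Tableaux App. B (5), relative
  to an orientation family `μ`; Poincaré duality is the tree's theorem), and
  `restrictCompl_fermatLinearSubspaceClass`: **it dies on `(X ∖ Z_{σ,ε})(ℂ)`** (the unconditional
  half of Deligne's Cor. 8.2.8, `iSup_range_complexGysin_le_ker_restrictCompl'`).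
* `FermatCharacter.claim_of_projector_fermatLinearSubspaceClass_ne_zero` (one character) and
  `Shioda_claim_paired_of_projector_fermatLinearSubspaceClass_ne_zero` — claim(δ), resp. the named
  fact, from (A) and **`π_δ(cl L_{σ,ε}) ≠ 0`** for some `ε` with `εᵢᵐ = -1` (Thm. 1-1:
  `ω_δ(L) ≠ 0`; Ran Prop. 1.14: the intersection matrix of the lines `L_{ij}` on `X²ₘ` is
  non-singular).

Literal form: `FermatCharacter.standardPairing` (`σ₀ : 2j ↔ 2j + 1`, pairing Aoki's
`(a₀, -a₀, …, a_r, -a_r)` = `FermatCharacter.standardPaired a` of `FermatInductiveClaimsLiteralForms`)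
and `Shioda_claim_paired_of_projector_standardLinearSubspaceClass_ne_zero` — the named fact from
(A) and `ω_δ(L) ≠ 0` for Shioda's `L : x_{2j} = ε_{2j} x_{2j+1}` and `δ = (a₀, -a₀, …)` ONLY
(THEOREM 1-1 exactly as printed), through the tree's `Shioda_claim_paired_of_standardPaired`
(permutation invariance of claim).

## What is NOT here

`π_δ(cl L) ≠ 0` itself (the intersection numbers `L · g(L)`, or Ran's `∗`-products from the
surface case) and (A) (Ran Prop. 1.7 (i)): the two remaining inputs of `Shioda_claim_paired_holds`.

## References

* [Aoki1987] N. Aoki, J. Math. Soc. Japan 39 (1987) 385–396, Thm. 1-1, p. 386 (text read, J-STAGE).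
* [Ran1980] Z. Ran, Compositio Math. 42 (1980), Prop. 1.14, Thm. 4.9. [FultonYoungTableaux1997]
  App. B §B.1 (5). [DeligneHodgeIII1974] Cor. 8.2.8. [Hartshorne1977] II Ex. 3.11 (d), 7.1.1.
-/

noncomputable section

open CategoryTheory AlgebraicGeometry MvPolynomial

namespace Literature.AlgebraicGeometry.HodgeTheory

open Literature.AlgebraicGeometry.Motives Literature.AlgebraicTopology.SingularHomology Finset

attribute [local instance] MvPolynomial.gradedAlgebra Motives.ProjBaseChange.algebraBase

variable {n m r : ℕ}

/-! ### Sums over the orbits of a fixed-point-free involution -/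

/-- For a fixed-point-free involution `σ`: `Σᵢ f i = Σ_{i < σ i} (f i + f (σ i))`. [folklore] -/
theorem sum_eq_sum_filter_lt_add {M : Type*} [AddCommMonoid M] {σ : Equiv.Perm (Fin (n + 2))}
    (h1 : ∀ i, σ i ≠ i) (h2 : ∀ i, σ (σ i) = i) (f : Fin (n + 2) → M) :
    ∑ i, f i = ∑ i ∈ ({i | i < σ i} : Finset (Fin (n + 2))), (f i + f (σ i)) := by
  rw [Finset.sum_add_distrib, ← Finset.sum_add_sum_compl ({i | i < σ i} : Finset (Fin (n + 2))) f]
  congr 1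
  refine (Finset.sum_bij (fun i _ ↦ σ i) (fun i hi ↦ ?_) (fun i _ j _ h ↦ σ.injective h)
    (fun j hj ↦ ⟨σ j, ?_, h2 j⟩) (fun i _ ↦ rfl)).symm
  · simp only [mem_compl, mem_filter, mem_univ, true_and] at hi ⊢
    exact not_lt_perm_perm h2 hi
  · simp only [mem_compl, mem_filter, mem_univ, true_and] at hj ⊢
    rw [h2]
    exact lt_of_le_of_ne (not_lt.mp hj) (h1 j)

/-! ### Indexing the orbits and the parametrising substitution -/

/-- The index in `Fin (r + 1)` of the orbit `{i, σ i}` of a letter `i`, numbering the orbits of a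
fixed-point-free involution `σ` of `2r + 2` letters by their smaller elements in increasing order
(junk value `0` when `σ` is not such an involution). [folklore] -/
def pairOrbitIndex (σ : Equiv.Perm (Fin (2 * r + 2))) (i : Fin (2 * r + 2)) : Fin (r + 1) :=
  if h : #{i | i < σ i} = r + 1 then
    if hi : min i (σ i) ∈ ({i | i < σ i} : Finset (Fin (2 * r + 2))) then
      (Finset.orderIsoOfFin _ h).symm ⟨min i (σ i), hi⟩
    else 0
  else 0

/-- The smaller element of the orbit of `i` is a smaller element. [folklore] -/
theorem min_mem_filter_lt {σ : Equiv.Perm (Fin (2 * r + 2))} (h1 : ∀ i, σ i ≠ i)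
    (h2 : ∀ i, σ (σ i) = i) (i : Fin (2 * r + 2)) :
    min i (σ i) ∈ ({i | i < σ i} : Finset (Fin (2 * r + 2))) := by
  simp only [mem_filter, mem_univ, true_and]
  rcases lt_or_gt_of_ne (h1 i) with h | h
  · rw [min_eq_right h.le, h2]; exact h
  · rw [min_eq_left h.le]; exact h

/-- `pairOrbitIndex` is constant on orbits. [folklore] -/
theorem pairOrbitIndex_perm {σ : Equiv.Perm (Fin (2 * r + 2))} (h2 : ∀ i, σ (σ i) = i)
    (i : Fin (2 * r + 2)) : pairOrbitIndex σ (σ i) = pairOrbitIndex σ i := by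
  unfold pairOrbitIndex
  rw [h2, min_comm]

/-- The numbering `e` of the smaller elements inverts `pairOrbitIndex`: `pairOrbitIndex σ (e j) = j`. [folklore] -/
theorem pairOrbitIndex_orderEmbOfFin {σ : Equiv.Perm (Fin (2 * r + 2))} (h1 : ∀ i, σ i ≠ i)
    (h2 : ∀ i, σ (σ i) = i) (j : Fin (r + 1)) :
    pairOrbitIndex σ (Finset.orderEmbOfFin _ (card_filter_lt_perm h1 h2) j) = j := by
  have hcard := card_filter_lt_perm h1 h2
  set e := Finset.orderEmbOfFin ({i | i < σ i} : Finset (Fin (2 * r + 2))) hcard with he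
  have hej : e j < σ (e j) := by
    have h := Finset.orderEmbOfFin_mem ({i | i < σ i} : Finset (Fin (2 * r + 2))) hcard j
    rw [mem_filter] at h
    exact h.2
  have hmin : min (e j) (σ (e j)) = e j := min_eq_left hej.le
  rw [pairOrbitIndex, dif_pos hcard, dif_pos (hmin ▸ min_mem_filter_lt h1 h2 (e j))]
  apply (Finset.orderIsoOfFin _ hcard).symm_apply_eq.mpr
  apply Subtype.ext
  simp only [hmin]
  rfl

/-- **The substitution parametrising `L_{σ,ε}`**: `xᵢ ↦ εᵢ y_{[i]}` for the smaller element `i` of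
an orbit and `x_{σ i} ↦ y_{[i]}` for the larger one (`[i]` the orbit's index), so that
`xᵢ - εᵢ x_{σ i} ↦ 0`; these are the homogeneous coordinates `y` of `L ≅ ℙʳ`
(`x_{σ i} = y_{[i]}`, `xᵢ = εᵢ y_{[i]}`). [cite: Aoki1987, Thm. 1-1] -/
def pairedSubst (σ : Equiv.Perm (Fin (2 * r + 2))) (ε : Fin (2 * r + 2) → ℂ) (i : Fin (2 * r + 2)) :
    MvPolynomial (Fin (r + 1)) ℂ :=
  if i < σ i then C (ε i) * X (pairOrbitIndex σ i) else X (pairOrbitIndex σ i)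

/-- The forms of the parametrising substitution are linear. [folklore] -/
theorem isHomogeneous_pairedSubst (σ : Equiv.Perm (Fin (2 * r + 2))) (ε : Fin (2 * r + 2) → ℂ)
    (i : Fin (2 * r + 2)) : (pairedSubst σ ε i).IsHomogeneous 1 := by
  unfold pairedSubst
  split_ifs
  · exact isHomogeneous_C_mul_X _ _
  · exact isHomogeneous_X _ _

/-- Every `y_j` is hit: `y_j` is the image of `x_{σ (e j)}`, `e j` the `j`-th smaller element. [folklore] -/
theorem exists_pairedSubst_eq_X {σ : Equiv.Perm (Fin (2 * r + 2))} (h1 : ∀ i, σ i ≠ i)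
    (h2 : ∀ i, σ (σ i) = i) (ε : Fin (2 * r + 2) → ℂ) (j : Fin (r + 1)) :
    ∃ i, pairedSubst σ ε i = X j := by
  have hcard := card_filter_lt_perm h1 h2
  refine ⟨σ (Finset.orderEmbOfFin _ hcard j), ?_⟩
  have hej : Finset.orderEmbOfFin _ hcard j < σ (Finset.orderEmbOfFin _ hcard j) := by
    have h := Finset.orderEmbOfFin_mem ({i | i < σ i} : Finset (Fin (2 * r + 2))) hcard j
    rw [mem_filter] at h
    exact h.2
  rw [pairedSubst, if_neg (not_lt_perm_perm h2 hej), pairOrbitIndex_perm h2, pairOrbitIndex_orderEmbOfFin h1 h2]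

/-- The substitution kills the equations of `L_{σ,ε}`: `σ_τ(xᵢ - εᵢ x_{σ i}) = 0` for `i < σ i`.
[folklore] -/
theorem aeval_pairedSubst_pairedLinearForm {σ : Equiv.Perm (Fin (2 * r + 2))} (h2 : ∀ i, σ (σ i) = i)
    (ε : Fin (2 * r + 2) → ℂ) {i : Fin (2 * r + 2)} (hi : i < σ i) :
    aeval (pairedSubst σ ε) (pairedLinearForm σ ε i) = 0 := by
  simp only [pairedLinearForm, map_sub, map_mul, aeval_C, aeval_X, pairedSubst, if_pos hi,
    if_neg (not_lt_perm_perm h2 hi), pairOrbitIndex_perm h2, MvPolynomial.algebraMap_eq, sub_self]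

/-- The substitution kills the Fermat form when `εᵢᵐ = -1` on the smaller elements:
`σ_τ(Σ xᵢᵐ) = Σ_{i < σ i} (εᵢᵐ + 1) y_{[i]}ᵐ = 0` — i.e. `L_{σ,ε} ⊆ X²ʳₘ`. [cite: Aoki1987, Thm. 1-1] -/
theorem aeval_pairedSubst_fermatPolynomial {σ : Equiv.Perm (Fin (2 * r + 2))} (h1 : ∀ i, σ i ≠ i)
    (h2 : ∀ i, σ (σ i) = i) {ε : Fin (2 * r + 2) → ℂ} (hε : ∀ i, i < σ i → ε i ^ m = -1) :
    aeval (pairedSubst σ ε) (fermatPolynomial ℂ (2 * r) m) = 0 := by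
  rw [fermatPolynomial, map_sum, sum_eq_sum_filter_lt_add h1 h2]
  refine Finset.sum_eq_zero fun i hi ↦ ?_
  rw [mem_filter] at hi
  have hi' : i < σ i := hi.2
  show aeval (pairedSubst σ ε) (X i ^ m) + aeval (pairedSubst σ ε) (X (σ i) ^ m) = 0
  have hA : pairedSubst σ ε i = C (ε i) * X (pairOrbitIndex σ i) := if_pos hi'
  have hB : pairedSubst σ ε (σ i) = X (pairOrbitIndex σ i) := by
    rw [pairedSubst, if_neg (not_lt_perm_perm h2 hi'), pairOrbitIndex_perm h2]
  rw [map_pow, map_pow, aeval_X, aeval_X, hA, hB, mul_pow, ← map_pow, hε i hi', map_neg, map_one,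
    neg_one_mul, neg_add_cancel]

/-! ### The embedding `ℙʳ ⟶ X²ʳₘ` onto `L_{σ,ε}` -/

section Embedding

variable {σ : Equiv.Perm (Fin (2 * r + 2))} (h1 : ∀ i, σ i ≠ i) (h2 : ∀ i, σ (σ i) = i)
  (ε : Fin (2 * r + 2) → ℂ) (hε : ∀ i, i < σ i → ε i ^ m = -1)

/-- The linear map `ℙʳ_ℂ → ℙ²ʳ⁺¹_ℂ` parametrising `L_{σ,ε}` (`Motives.ProjectiveSpace.linSubstMap`
of `pairedSubst`). [cite: Aoki1987, Thm. 1-1] -/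
def pairedLinEmb : projectiveSpace r ℂ ⟶ projectiveSpace (2 * r + 1) ℂ :=
  ProjectiveSpace.linSubstMap (pairedSubst σ ε) (isHomogeneous_pairedSubst σ ε)
    (exists_pairedSubst_eq_X h1 h2 ε)

include hε in
/-- Its image lies on the Fermat hypersurface `V₊(Σ xᵢᵐ)` (`εᵢᵐ = -1`). [cite: Aoki1987, Thm. 1-1] -/
theorem range_pairedLinEmb_subset :
    Set.range (pairedLinEmb h1 h2 ε).left ⊆
      Set.range (SmoothHypersurface.hypersurfaceι (fermatPolynomial ℂ (2 * r) m)).left := by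
  rw [SmoothHypersurface.range_hypersurfaceι]
  rintro _ ⟨q, rfl⟩
  exact ProjectiveSpace.linSubstMap_mem_zeroLocus_of_aeval_eq_zero _ _ _ q
    (fun p hp ↦ by rw [Set.mem_singleton_iff.mp hp]; exact aeval_pairedSubst_fermatPolynomial h1 h2 hε)

variable (m) in
/-- **The embedding `g : ℙʳ_ℂ ⟶ X²ʳₘ` of the linear subspace `L_{σ,ε}`** (`εᵢᵐ = -1`), over `ℂ`:
the linear map `ℙʳ → ℙ²ʳ⁺¹` lifted through the reduced closed subscheme `X²ʳₘ = V₊(Σ xᵢᵐ)`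
(`Motives.liftOfRangeSubset`, Hartshorne II Ex. 3.11 (d)). [cite: Aoki1987, Thm. 1-1] -/
def linearSubspaceEmb : projectiveSpace r ℂ ⟶ fermatHypersurface (2 * r) m :=
  Over.homMk (liftOfRangeSubset (SmoothHypersurface.hypersurfaceι (fermatPolynomial ℂ (2 * r) m)).left
    (pairedLinEmb h1 h2 ε).left (range_pairedLinEmb_subset (m := m) h1 h2 ε hε)) (by
      rw [← Over.w (SmoothHypersurface.hypersurfaceι (fermatPolynomial ℂ (2 * r) m)),
        liftOfRangeSubset_comp_assoc, Over.w (pairedLinEmb h1 h2 ε)])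

/-- `g ≫ (X ↪ ℙ²ʳ⁺¹)` is the linear map (underlying schemes). [folklore] -/
theorem linearSubspaceEmb_left_comp_ι :
    (linearSubspaceEmb m h1 h2 ε hε).left ≫ (SmoothHypersurface.hypersurfaceι (fermatPolynomial ℂ (2 * r) m)).left =
      (pairedLinEmb h1 h2 ε).left :=
  liftOfRangeSubset_comp _ _ (range_pairedLinEmb_subset h1 h2 ε hε)

/-- **The image of `g` lies in `Z_{σ,ε} = X ∩ L_{σ,ε}`** (the substitution kills the equations
`xᵢ - εᵢ x_{σ i}`). [cite: Aoki1987, Thm. 1-1] -/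
theorem range_linearSubspaceEmb_subset :
    Set.range (linearSubspaceEmb m h1 h2 ε hε).left.base ⊆ fermatLinearSection m σ ε := by
  rintro _ ⟨q, rfl⟩
  change (SmoothHypersurface.hypersurfaceι (fermatPolynomial ℂ (2 * r) m)).left.base
    ((linearSubspaceEmb m h1 h2 ε hε).left.base q) ∈ pairedLinearSubspace σ ε
  rw [← Scheme.Hom.comp_apply, linearSubspaceEmb_left_comp_ι]
  exact ProjectiveSpace.linSubstMap_mem_zeroLocus_of_aeval_eq_zero _ _ _ q (by
    rintro _ ⟨i, hi, rfl⟩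
    exact aeval_pairedSubst_pairedLinearForm h2 ε hi)

end Embedding

/-! ### The Gysin class of the linear subspace and its support -/

section GysinClass

variable (μ : OrientationFamily) {σ : Equiv.Perm (Fin (2 * r + 2))} (h1 : ∀ i, σ i ≠ i)
  (h2 : ∀ i, σ (σ i) = i) (ε : Fin (2 * r + 2) → ℂ) (hε : ∀ i, i < σ i → ε i ^ m = -1)

variable (m) in
/-- **The cycle class `cl(L_{σ,ε}) = g_* 1 ∈ H²ʳ(X²ʳₘ(ℂ); ℂ)` of Shioda's linear subspace**
(`r ≥ 1`, `m ≥ 1`, `εᵢᵐ = -1`): the Gysin image (`complexGysin`, relative to the orientation family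
`μ`; Fulton, Young Tableaux App. B (5): "`[V]` in `H^{2n-2k}X`") of `1 ∈ H⁰(ℙʳ(ℂ); ℂ)` along the
embedding `g : ℙʳ ⟶ X²ʳₘ` onto `L_{σ,ε}`. [cite: Aoki1987, Thm. 1-1] [cite: FultonYoungTableaux1997, Appendix B §B.1 (5)] -/
def fermatLinearSubspaceClass (hr : 1 ≤ r) (hm : 1 ≤ m) : complexBetti (fermatHypersurface (2 * r) m) (2 * r) :=
  complexGysin μ (isSmoothProjective_projectiveSpace_holds ℂ r)
    (isSmoothProjective_fermatHypersurface (n := 2 * r) (by omega) hm) (linearSubspaceEmb m h1 h2 ε hε)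
    (show 0 + 2 * (2 * r) = 2 * r + 2 * r by ring)
    (singularCohomology.one ℂ (ComplexPoints (projectiveSpace r ℂ)))

/-- **`cl(L_{σ,ε})` is supported on `Z_{σ,ε} = X²ʳₘ ∩ L_{σ,ε}`**: it dies on `(X ∖ Z)(ℂ)` — Gysin
images die off the image (the tree's unconditional half of Deligne's Cor. 8.2.8,
`iSup_range_complexGysin_le_ker_restrictCompl'`), and `g(ℙʳ) ⊆ Z_{σ,ε}`.
[cite: DeligneHodgeIII1974, Cor. 8.2.8] [cite: Aoki1987, Thm. 1-1] -/
theorem restrictCompl_fermatLinearSubspaceClass (hr : 1 ≤ r) (hm : 1 ≤ m) :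
    complexBetti.restrictCompl (fermatHypersurface (2 * r) m) (fermatLinearSection m σ ε) (2 * r)
      (fermatLinearSubspaceClass m μ h1 h2 ε hε hr hm) = 0 := by
  refine complexBetti.restrictCompl_eq_zero_of_subset
    (S := ⋃ _ : Unit, Set.range (linearSubspaceEmb m h1 h2 ε hε).left.base)
    (Set.iUnion_subset fun _ ↦ range_linearSubspaceEmb_subset h1 h2 ε hε) ?_
  have hX := isSmoothProjective_fermatHypersurface (n := 2 * r) (m := m) (by omega) hm
  have key := iSup_range_complexGysin_le_ker_restrictCompl' μ hX (ι := Unit) (m := fun _ ↦ r)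
    (Y := fun _ ↦ projectiveSpace r ℂ) (fun _ ↦ isSmoothProjective_projectiveSpace_holds ℂ r)
    (fun _ ↦ linearSubspaceEmb m h1 h2 ε hε) (2 * r)
  refine LinearMap.mem_ker.mp (key ?_)
  refine Submodule.mem_iSup_of_mem () (Submodule.mem_iSup_of_mem 0
    (Submodule.mem_iSup_of_mem (show 0 + 2 * (2 * r) = 2 * r + 2 * r by ring) ⟨_, rfl⟩))

end GysinClass

/-! ### claim(δ) from `ω_δ(L) ≠ 0`, one character at a time -/

/-- **claim(δ) from (A) and `π_δ(cl L_{σ,ε}) ≠ 0`** for ONE character `δ` of `X²ʳₘ` (`r ≥ 1`,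
`m ≥ 1`): if `V(δ)` is at most a line and the `δ`-component of the cycle class of some linear
subspace `L_{σ,ε} ⊆ X²ʳₘ` (`σ` a fixed-point-free involution, `εᵢᵐ = -1`) is non-zero, then
`V(δ)` consists of algebraic classes — `cl L` is supported on the codimension-`r` closed subset
`Z_{σ,ε}` (`restrictCompl_fermatLinearSubspaceClass`, `le_coheight_of_mem_fermatLinearSection`) and
"represents ⟹ claim" (`FermatCharacter.claim_of_supportedClass`). (No relation between `δ` and `σ`
is needed for the implication; `δ ∘ σ = -δ` is what makes the hypothesis true, Thm. 1-1.)
[cite: Aoki1987, Thm. 1-1 and p. 386] -/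
theorem FermatCharacter.claim_of_projector_fermatLinearSubspaceClass_ne_zero [NeZero m] (hr : 1 ≤ r)
    {δ : Fin (2 * r + 2) → ZMod m} (hdim : ∃ v, fermatEigenspace m δ (2 * r) ≤ ℂ ∙ v)
    (μ : OrientationFamily) {σ : Equiv.Perm (Fin (2 * r + 2))} (h1 : ∀ i, σ i ≠ i)
    (h2 : ∀ i, σ (σ i) = i) (ε : Fin (2 * r + 2) → ℂ) (hε : ∀ i, i < σ i → ε i ^ m = -1)
    (hne : fermatProjector m δ (2 * r)
      (fermatLinearSubspaceClass m μ h1 h2 ε hε hr NeZero.one_le) ≠ 0) :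
    FermatCharacter.Claim m r δ :=
  FermatCharacter.claim_of_supportedClass hdim (isClosed_fermatLinearSection σ ε)
    (fun _ hz ↦ le_coheight_of_mem_fermatLinearSection NeZero.one_le h1 h2 ε hz)
    (restrictCompl_fermatLinearSubspaceClass μ h1 h2 ε hε hr NeZero.one_le) hne

/-! ### `Shioda_claim_paired` from `ω_δ(L) ≠ 0` -/

/-- **`Shioda_claim_paired` from (A) and the printed non-vanishing `ω_δ(L) ≠ 0`.** Granted (A)
(`hE1`: `V(α)` is at most a line for `α ∈ 𝔄²ʳₘ`, Ran Prop. 1.7 (i)) and, for every `r ≥ 1`, `m ≥ 1`,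
every fixed-point-free involution `σ` of the coordinates and every character `δ` with all `δᵢ ≠ 0`,
`δ (σ i) = -δ i`, the existence of scalars `ε` with `εᵢᵐ = -1` (`i < σ i`) and an orientation
family `μ` such that the `δ`-component of the cycle class of `L_{σ,ε}` is non-zero —
`π_δ (g_* 1) ≠ 0`, Aoki's `ω_δ(L) ≠ 0` (THEOREM 1-1) — the named fact holds: `g_* 1` is supported
on `Z_{σ,ε}` (`restrictCompl_fermatLinearSubspaceClass`) and
`Shioda_claim_paired_of_linearSubspace_represents` applies.
[cite: Aoki1987, Thm. 1-1 and p. 386] [cite: Ran1980, §1 Prop. 1.7 (i) and Prop. 1.14] -/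
theorem Shioda_claim_paired_of_projector_fermatLinearSubspaceClass_ne_zero
    (hE1 : ∀ (m r : ℕ) [NeZero m] (α : Fin (2 * r + 2) → ZMod m), 0 < r →
      FermatCharacter.IsAdmissible α → ∃ v, fermatEigenspace m α (2 * r) ≤ ℂ ∙ v)
    (hω : ∀ (m r : ℕ) [NeZero m] (δ : Fin (2 * r + 2) → ZMod m) (σ : Equiv.Perm (Fin (2 * r + 2)))
      (hr : 1 ≤ r) (h1 : ∀ i, σ i ≠ i) (h2 : ∀ i, σ (σ i) = i), (∀ i, δ i ≠ 0) →
      (∀ i, δ (σ i) = -δ i) →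
      ∃ (μ : OrientationFamily) (ε : Fin (2 * r + 2) → ℂ) (hε : ∀ i, i < σ i → ε i ^ m = -1),
        fermatProjector m δ (2 * r)
          (fermatLinearSubspaceClass m μ h1 h2 ε hε hr NeZero.one_le) ≠ 0) :
    Shioda_claim_paired := by
  refine Shioda_claim_paired_of_linearSubspace_represents hE1 fun m r _ δ σ hr hδ h1 h2 hδσ ↦ ?_
  obtain ⟨μ, ε, hε, hne⟩ := hω m r δ σ hr h1 h2 hδ hδσ
  exact ⟨ε, _, restrictCompl_fermatLinearSubspaceClass μ h1 h2 ε hε hr NeZero.one_le, hne⟩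

/-! ### The literal form of Thm. 1-1: the standard pairing `2j ↔ 2j + 1` -/

namespace FermatCharacter

/-- **The standard pairing of the coordinates of `X²ʳₘ`**: the fixed-point-free involution
`2j ↔ 2j + 1` (`(j, b) ↦ (j, b + 1)` transported along `pairIndexEquiv`), under which Aoki's
`δ = (a₀, -a₀, …, a_r, -a_r)` (`standardPaired a`) is paired and whose linear subspaces
`L_{σ₀,ε} : x_{2j} = ε_{2j} x_{2j+1}` are Shioda's `L : x_{2i} + ε x_{2i+1} = 0` (Thm. 1-1).
[cite: Aoki1987, §1 pp. 386–387 and Thm. 1-1] -/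
def standardPairing (r : ℕ) : Equiv.Perm (Fin (2 * r + 2)) :=
  (pairIndexEquiv.symm.trans (Equiv.prodCongr (Equiv.refl _) (Equiv.addRight (1 : Fin 2)))).trans
    pairIndexEquiv

/-- `σ₀ (2j + b) = 2j + (b + 1)`. [folklore] -/
theorem standardPairing_pairIndex (j : Fin (r + 1)) (b : Fin 2) :
    standardPairing r (pairIndex j b) = pairIndex j (b + 1) := by
  rw [standardPairing, ← pairIndexEquiv_apply, Equiv.trans_apply, Equiv.trans_apply,
    Equiv.symm_apply_apply]
  rfl

/-- `σ₀` has no fixed point. [folklore] -/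
theorem standardPairing_ne (i : Fin (2 * r + 2)) : standardPairing r i ≠ i := by
  obtain ⟨⟨j, b⟩, rfl⟩ := pairIndexEquiv.surjective i
  rw [pairIndexEquiv_apply, standardPairing_pairIndex]
  intro h
  have h' := congrArg (fun i ↦ (pairIndexEquiv.symm i).2) h
  simp only [← pairIndexEquiv_apply, Equiv.symm_apply_apply] at h'
  fin_cases b <;> simp at h'

/-- `σ₀` is an involution. [folklore] -/
theorem standardPairing_standardPairing (i : Fin (2 * r + 2)) :
    standardPairing r (standardPairing r i) = i := by
  obtain ⟨⟨j, b⟩, rfl⟩ := pairIndexEquiv.surjective i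
  rw [pairIndexEquiv_apply, standardPairing_pairIndex, standardPairing_pairIndex]
  congr 1
  fin_cases b <;> rfl

/-- `(a₀, -a₀, …, a_r, -a_r)` is paired by `σ₀`: `δ (σ₀ i) = -δ i`. [cite: Aoki1987, §1 p. 386] -/
theorem standardPaired_standardPairing (a : Fin (r + 1) → ZMod m) (i : Fin (2 * r + 2)) :
    standardPaired a (standardPairing r i) = -standardPaired a i := by
  obtain ⟨⟨j, b⟩, rfl⟩ := pairIndexEquiv.surjective i
  rw [pairIndexEquiv_apply, standardPairing_pairIndex]
  fin_cases b <;> simp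

end FermatCharacter

/-- **`Shioda_claim_paired` from (A) and THEOREM 1-1 in its literal printed form.** Granted `hE1`
and, for every `r ≥ 1`, `m ≥ 1` and all `a₀, …, a_r ∈ ℤ/m ∖ {0}`, an orientation family `μ` and
scalars `ε` with `ε_{2j}ᵐ = -1` such that the cycle class of Shioda's linear space
`L : x_{2j} = ε_{2j} x_{2j+1}` (`0 ≤ j ≤ r`) — the `L_{σ₀,ε}` of the standard pairing `σ₀` — has
non-zero `δ`-component for `δ = (a₀, -a₀, …, a_r, -a_r)` ("`L` represents `δ`":
`ω_δ(L)·\overline{ω_δ(L)} = (-1)ʳ mⁿ⁺¹ ≠ 0`), the named fact holds: claim(δ) by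
`FermatCharacter.claim_of_projector_fermatLinearSubspaceClass_ne_zero`, and every paired character
is such a `δ` up to a permutation of the coordinates (the tree's
`Shioda_claim_paired_of_standardPaired`, `FermatInductiveClaimsLiteralForms`).
[cite: Aoki1987, Thm. 1-1 (p. 387) and p. 386] [cite: Ran1980, §1 Prop. 1.7 (i) and Prop. 1.14] -/
theorem Shioda_claim_paired_of_projector_standardLinearSubspaceClass_ne_zero
    (hE1 : ∀ (m r : ℕ) [NeZero m] (α : Fin (2 * r + 2) → ZMod m), 0 < r →
      FermatCharacter.IsAdmissible α → ∃ v, fermatEigenspace m α (2 * r) ≤ ℂ ∙ v)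
    (hω : ∀ (m r : ℕ) [NeZero m] (a : Fin (r + 1) → ZMod m) (hr : 1 ≤ r), (∀ j, a j ≠ 0) →
      ∃ (μ : OrientationFamily) (ε : Fin (2 * r + 2) → ℂ)
        (hε : ∀ i, i < FermatCharacter.standardPairing r i → ε i ^ m = -1),
        fermatProjector m (FermatCharacter.standardPaired a) (2 * r)
          (fermatLinearSubspaceClass m μ FermatCharacter.standardPairing_ne
            FermatCharacter.standardPairing_standardPairing ε hε hr NeZero.one_le) ≠ 0) :
    Shioda_claim_paired := by
  refine Shioda_claim_paired_of_standardPaired fun m r _ a ha ↦ ?_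
  rcases Nat.eq_zero_or_pos r with rfl | hr
  · exact FermatCharacter.claim_zero m _
  obtain ⟨μ, ε, hε, hne⟩ := hω m r a hr ha
  have hadm : FermatCharacter.IsAdmissible (FermatCharacter.standardPaired a) :=
    (FermatCharacter.isPaired_standardPaired a).isAdmissible
      (FermatCharacter.standardPaired_ne_zero ha)
  exact FermatCharacter.claim_of_projector_fermatLinearSubspaceClass_ne_zero hr (hE1 m r _ hr hadm)
    μ _ _ ε hε hne

end Literature.AlgebraicGeometry.HodgeTheory

end
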